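import Literature.NumberTheory.Automorphic.ParabolicGL
import HarnessLib

/-!
# Refining a block labelling by one cut, and the transitivity step for Jacquet modules
(sibling proof file towards `Literature.NumberTheory.Automorphic.bernsteinZelevinsky_support`)

Let `c : Fin n → Fin r` be a monotone block labelling of `GL_n` (an ordered partition
`n = n₁ + ⋯ + n_r`, Bernstein–Zelevinsky 1977, Example 2.2) and `p : Fin n` a position. Cutting
the block of `p` after `p` gives the refined labelling `cutRefine c p : Fin n → Fin (r + 1)`
(`c = Fin.predAbove (c p) ∘ cutRefine c p`, monotone, and surjective as soon as `c` is and the cut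
is proper, i.e. some `q > p` lies in the block of `p`): in Bernstein–Zelevinsky's language the
standard subgroup `G_β < G_γ` of a one-step subpartition `β` of `γ` (1977, 2.2). This file proves
the group-theoretic and linear-algebraic input of the step "`r_{β,γ} (r_γ π) = r_β π`" of the proof
of the existence of the cuspidal support (Bernstein–Zelevinsky 1977, Prop. 2.3 (c)
`r_{N,M} ∘ r_{M,G} = r_{N,G}`; 1976, §3), in the elementary form that avoids identifying the two
sides:

* `cutUnipotent R c p ≤ Π_a GL_{n_a}(R)`: the unipotent radical, inside the Levi of `c`, of the
  cut — identity in the blocks `a ≠ c p`, and in the block of `p` a unipotent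
  `1 + X` with `X` supported on the rows `≤ p` and columns `> p`
  (`Literature.NumberTheory.Automorphic.unipotentRadicalGL` of the two-valued labelling `cutLabel c p`);
* `leviProjection_mem_cutUnipotent`: the Levi component (for `c`) of an element of the unipotent
  radical `U_{c'}` of the refinement `c' = cutRefine c p` lies in `cutUnipotent R c p`, so that
  `U_{c'} ⊆ emb (cutUnipotent) · U_c`;
* `coinvariantsKer_cutRefine_le`: consequently, for any representation `π` of `GL_n(R)`,
  `V(U_{c'}) ≤ V(U_c) + span {π(emb m) v - v : m ∈ cutUnipotent}` (where `V(H)` denotes the span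
  of the `π(h) v - v`, Mathlib `Representation.Coinvariants.ker`);
* `coinvariantsKer_comp_cutUnipotent_eq_top`: hence if `V(U_{c'}) = V` (the Jacquet module `r_{c'} π`
  vanishes) then for every quotient `σ` of the Jacquet module `r_c π` (`Representation.jacquetGL`)
  the `cutUnipotent`-coinvariants of `σ` vanish — the form in which "`r_{c'} π = 0` implies that
  the cuspidal datum extracted from `r_c π` is quasi-cuspidal at the cut" is consumed by the
  support theorem.

Everything is over an arbitrary commutative ring `R` (no topology) and coefficient ring `k`.
The only definitions are the three real ones `cutRefine`, `cutLabel`, `cutUnipotent`; no named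
facts.

## References

* I. N. Bernstein, A. V. Zelevinsky, *Induced representations of reductive `p`-adic groups I*,
  Ann. Sci. ÉNS 10 (1977), §2.1–2.3 (Example 2.2, Prop. 2.3 (c)), Thm. 2.5.
* I. N. Bernstein, A. V. Zelevinsky, *Representations of the group `GL(n, F)` where `F` is a
  non-archimedean local field*, Russian Math. Surveys 31:3 (1976), §3 (the functors `r_{β,γ}`).
-/

noncomputable section

open scoped MatrixGroups

namespace Literature.NumberTheory.Automorphic

/-! ### The refined labelling -/

section CutRefine

variable {n r : ℕ}

/-- **Cutting the block of `p` after `p`**: the refined labelling `Fin n → Fin (r + 1)`,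
`i ↦ c i` (cast) for `i ≤ p` and `i ↦ c i + 1` for `i > p`. For `c` monotone this splits the block
of `p` into `{i | c i = c p, i ≤ p}` and `{i | c i = c p, p < i}` and renumbers the later blocks
(a one-step subpartition, Bernstein–Zelevinsky 1977, Example 2.2). [cite: BernsteinZelevinsky1977, Example 2.2] -/
def cutRefine (c : Fin n → Fin r) (p : Fin n) : Fin n → Fin (r + 1) :=
  fun i => if i ≤ p then Fin.castSucc (c i) else Fin.succ (c i)

/-- `cutRefine c p i = c i` (cast) for `i ≤ p`. [folklore] -/
lemma cutRefine_of_le {c : Fin n → Fin r} {p i : Fin n} (h : i ≤ p) :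
    cutRefine c p i = Fin.castSucc (c i) :=
  if_pos h

/-- `cutRefine c p i = c i + 1` for `p < i`. [folklore] -/
lemma cutRefine_of_lt {c : Fin n → Fin r} {p i : Fin n} (h : p < i) :
    cutRefine c p i = Fin.succ (c i) :=
  if_neg (not_le.2 h)

/-- The refinement of a monotone labelling is monotone. [folklore] -/
theorem cutRefine_monotone {c : Fin n → Fin r} (hc : Monotone c) (p : Fin n) :
    Monotone (cutRefine c p) := by
  intro i j hij
  by_cases hi : i ≤ p
  · by_cases hj : j ≤ p
    · rw [cutRefine_of_le hi, cutRefine_of_le hj]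
      exact Fin.castSucc_le_castSucc_iff.2 (hc hij)
    · rw [cutRefine_of_le hi, cutRefine_of_lt (not_le.1 hj)]
      exact (Fin.castSucc_le_castSucc_iff.2 (hc hij)).trans (Fin.castSucc_lt_succ).le
  · have hj : ¬ j ≤ p := fun hj => hi (hij.trans hj)
    rw [cutRefine_of_lt (not_le.1 hi), cutRefine_of_lt (not_le.1 hj)]
    exact Fin.succ_le_succ_iff.2 (hc hij)

/-- Forgetting the cut recovers `c`: `Fin.predAbove (c p) ∘ cutRefine c p = c` (for `c` monotone).
[folklore] -/
theorem predAbove_cutRefine {c : Fin n → Fin r} (hc : Monotone c) (p i : Fin n) :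
    Fin.predAbove (c p) (cutRefine c p i) = c i := by
  by_cases hi : i ≤ p
  · rw [cutRefine_of_le hi]
    exact Fin.predAbove_castSucc_of_le _ _ (hc hi)
  · rw [cutRefine_of_lt (not_le.1 hi)]
    exact Fin.predAbove_succ_of_le _ _ (hc (not_le.1 hi).le)

/-- `c j < c i` implies `cutRefine c p j < cutRefine c p i` (the refinement refines). [folklore] -/
theorem cutRefine_lt_of_lt {c : Fin n → Fin r} (hc : Monotone c) (p : Fin n) {i j : Fin n}
    (h : c j < c i) : cutRefine c p j < cutRefine c p i := by
  by_contra h'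
  have h1 := (Fin.predAboveOrderHom (c p)).monotone (not_lt.1 h')
  simp only [Fin.predAboveOrderHom_coe, predAbove_cutRefine hc] at h1
  exact absurd h (not_lt.2 h1)

/-- Indices in a common block `a ≠ c p` get the same refined label. [folklore] -/
theorem cutRefine_eq_of_eq {c : Fin n → Fin r} (hc : Monotone c) (p : Fin n) {i j : Fin n}
    (hij : c i = c j) (hi : c i ≠ c p) : cutRefine c p i = cutRefine c p j := by
  rcases lt_or_gt_of_ne hi with h | h
  · have hip : i ≤ p := le_of_lt (lt_of_not_ge fun h' => absurd (hc h') (not_le.2 h))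
    have hjp : j ≤ p := le_of_lt (lt_of_not_ge fun h' => absurd (hc h') (not_le.2 (hij ▸ h)))
    rw [cutRefine_of_le hip, cutRefine_of_le hjp, hij]
  · have hip : p < i := lt_of_not_ge fun h' => absurd (hc h') (not_le.2 h)
    have hjp : p < j := lt_of_not_ge fun h' => absurd (hc h') (not_le.2 (hij ▸ h))
    rw [cutRefine_of_lt hip, cutRefine_of_lt hjp, hij]

/-- The refinement of a surjective monotone labelling at a **proper** cut (some `q > p` in the
block of `p`) is surjective. [folklore] -/
theorem cutRefine_surjective {c : Fin n → Fin r} (hc : Monotone c) (hs : Function.Surjective c)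
    {p q : Fin n} (hpq : p < q) (hq : c q = c p) : Function.Surjective (cutRefine c p) := by
  intro b
  rcases le_or_gt b (Fin.castSucc (c p)) with hb | hb
  · -- `b = castSucc a` with `a ≤ c p`
    obtain ⟨a, rfl⟩ : ∃ a : Fin r, b = Fin.castSucc a :=
      ⟨b.castPred (Fin.ne_last_of_lt (hb.trans_lt (Fin.castSucc_lt_last _))), by simp⟩
    rw [Fin.castSucc_le_castSucc_iff] at hb
    rcases hb.lt_or_eq with hlt | heq
    · obtain ⟨i, rfl⟩ := hs a
      have hip : i ≤ p := le_of_lt (lt_of_not_ge fun h' => absurd (hc h') (not_le.2 hlt))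
      exact ⟨i, cutRefine_of_le hip⟩
    · exact ⟨p, by rw [cutRefine_of_le le_rfl, heq]⟩
  · -- `b = succ a` with `c p ≤ a`
    have hb0 : b ≠ 0 := fun h => by rw [h] at hb; exact absurd hb (not_lt.2 (Fin.zero_le _))
    obtain ⟨a, rfl⟩ : ∃ a : Fin r, b = Fin.succ a := ⟨b.pred hb0, by simp⟩
    have hpa : c p ≤ a := by
      rw [← Fin.castSucc_lt_succ_iff]
      exact hb
    rcases hpa.lt_or_eq with hlt | heq
    · obtain ⟨i, rfl⟩ := hs a
      have hip : p < i := lt_of_not_ge fun h' => absurd (hc h') (not_le.2 hlt)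
      exact ⟨i, cutRefine_of_lt hip⟩
    · exact ⟨q, by rw [cutRefine_of_lt hpq, hq, heq]⟩

end CutRefine

/-! ### The unipotent group of the cut inside the Levi -/

section CutUnipotent

variable (R : Type*) [CommRing R] {n r : ℕ}

/-- The two-valued labelling of the block of `p` describing the cut: `false` on the indices `≤ p`,
`true` on the indices `> p`. [folklore] -/
def cutLabel (c : Fin n → Fin r) (p : Fin n) : {i // c i = c p} → Bool :=
  fun i => decide (p < (i : Fin n))

/-- **The unipotent radical of the cut, inside the Levi** `Π_a GL_{n_a}(R)` of `c`: the elements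
which are the identity in every block `a ≠ c p` and, in the block of `p`, block unitriangular for
the cut (`1 + X` with `X` supported on rows `≤ p`, columns `> p`;
`Literature.NumberTheory.Automorphic.unipotentRadicalGL` of `cutLabel c p`). This is the unipotent
radical `U ∩ M_γ` of the standard subgroup `G_β < G_γ` for the one-step subpartition
(Bernstein–Zelevinsky 1977, §2.1–2.2). [cite: BernsteinZelevinsky1977, §2.1–2.2] -/
def cutUnipotent (c : Fin n → Fin r) (p : Fin n) : Subgroup (Π a, GL {i // c i = a} R) where
  carrier := {m | (∀ a, a ≠ c p → m a = 1) ∧ m (c p) ∈ unipotentRadicalGL R (cutLabel c p)}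
  one_mem' := ⟨fun _ _ => rfl, Subgroup.one_mem _⟩
  mul_mem' {m m'} hm hm' :=
    ⟨fun a ha => by rw [Pi.mul_apply, hm.1 a ha, hm'.1 a ha, one_mul],
      by rw [Pi.mul_apply]; exact Subgroup.mul_mem _ hm.2 hm'.2⟩
  inv_mem' {m} hm :=
    ⟨fun a ha => by rw [Pi.inv_apply, hm.1 a ha, inv_one],
      by rw [Pi.inv_apply]; exact Subgroup.inv_mem _ hm.2⟩

variable {R} in
/-- Membership in `cutUnipotent` (definitional unfolding). [folklore] -/
lemma mem_cutUnipotent_iff {c : Fin n → Fin r} {p : Fin n} {m : Π a, GL {i // c i = a} R} :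
    m ∈ cutUnipotent R c p ↔
      (∀ a, a ≠ c p → m a = 1) ∧ m (c p) ∈ unipotentRadicalGL R (cutLabel c p) :=
  Iff.rfl

variable {R} in
/-- Entries of an element of a unipotent radical `U_b`: block triangular, with identity diagonal
blocks. [folklore] -/
lemma apply_eq_of_mem_unipotentRadicalGL {m : Type*} [Fintype m] [DecidableEq m] {α : Type*}
    [LinearOrder α] (b : m → α) {u : GL m R} (hu : u ∈ unipotentRadicalGL R b) (i j : m)
    (h : b i = b j) : (u : Matrix m m R) i j = if i = j then 1 else 0 := by
  obtain ⟨-, hdiag⟩ := (mem_unipotentRadicalGL_iff b u).1 hu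
  have h1 := congrFun (congrFun (hdiag (b i)) ⟨i, rfl⟩) ⟨j, h.symm⟩
  rw [Matrix.toSquareBlock_def, Matrix.of_apply, Matrix.one_apply] at h1
  rw [h1]
  by_cases hij : i = j
  · subst hij; simp
  · rw [if_neg hij, if_neg]
    exact fun e => hij (congrArg Subtype.val e)

variable {c : Fin n → Fin r} (hc : Monotone c) (p : Fin n)
include hc

/-- `P_{c'} ≤ P_c` for the refinement `c' = cutRefine c p`. [folklore] -/
theorem mem_standardParabolicGL_of_cutRefine {u : GL (Fin n) R}
    (hu : u ∈ standardParabolicGL R (cutRefine c p)) : u ∈ standardParabolicGL R c :=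
  fun _ _ hij => hu (cutRefine_lt_of_lt hc p hij)

/-- **The Levi component of an element of `U_{c'}` is a cut unipotent.** For `u` in the unipotent
radical of the refinement `c' = cutRefine c p` (block unitriangular for `c'`), its diagonal blocks
for the coarser `c` are: the identity in the blocks `a ≠ c p` (there `c'` and `c` have the same
blocks), and in the block of `p` a matrix which is block unitriangular for the cut. Hence
`U_{c'} ⊆ emb (cutUnipotent) · U_c`. (Bernstein–Zelevinsky 1977, §2.1–2.2: `U_β = (U_β ∩ M_γ) U_γ`.)
[cite: BernsteinZelevinsky1977, §2.1–2.2] -/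
theorem leviProjection_mem_cutUnipotent {u : standardParabolicGL R (cutRefine c p)}
    (hu : u ∈ unipotentRadicalP R (cutRefine c p)) :
    leviProjection R c ⟨u, mem_standardParabolicGL_of_cutRefine R hc p u.2⟩ ∈ cutUnipotent R c p := by
  have hu' : (u : GL (Fin n) R) ∈ unipotentRadicalGL R (cutRefine c p) := ⟨u, hu, rfl⟩
  have hBT : ((u : GL (Fin n) R) : Matrix (Fin n) (Fin n) R).BlockTriangular (cutRefine c p) :=
    ((mem_unipotentRadicalGL_iff _ _).1 hu').1
  have hent := apply_eq_of_mem_unipotentRadicalGL (cutRefine c p) hu'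
  refine ⟨fun a ha => ?_, (mem_unipotentRadicalGL_iff _ _).2 ⟨?_, fun b => ?_⟩⟩
  · -- blocks `a ≠ c p` are identity
    ext i j
    rw [leviProjection_apply_coe, Units.val_one]
    change ((u : GL (Fin n) R) : Matrix (Fin n) (Fin n) R) i j = (1 : Matrix _ _ R) i j
    rw [hent _ _ (cutRefine_eq_of_eq hc p (i.2.trans j.2.symm) (by rw [i.2]; exact ha)),
      Matrix.one_apply]
    by_cases hij : i = j
    · subst hij; simp
    · rw [if_neg (fun e => hij (Subtype.ext e)), if_neg hij]
  · -- the block of `p` is block triangular for the cut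
    intro i j hij
    rw [leviProjection_apply_coe]
    apply hBT
    simp only [cutLabel, Bool.lt_iff, decide_eq_false_iff_not, not_lt, decide_eq_true_eq] at hij
    have hi : c (i : Fin n) = c p := i.2
    have hj : c (j : Fin n) = c p := j.2
    rw [cutRefine_of_le hij.1, cutRefine_of_lt hij.2, hi, hj]
    exact Fin.castSucc_lt_succ
  · -- with identity diagonal blocks
    ext i j
    rw [Matrix.toSquareBlock_def, Matrix.of_apply, leviProjection_apply_coe, Matrix.one_apply]
    have hij : cutRefine c p (i : {k // c k = c p}) = cutRefine c p (j : {k // c k = c p}) := by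
      have hi : c ((i : {k // c k = c p}) : Fin n) = c p := (i : {k // c k = c p}).2
      have hj : c ((j : {k // c k = c p}) : Fin n) = c p := (j : {k // c k = c p}).2
      have hb : cutLabel c p i = cutLabel c p j := i.2.trans j.2.symm
      simp only [cutLabel, decide_eq_decide] at hb
      by_cases h : p < ((i : {k // c k = c p}) : Fin n)
      · rw [cutRefine_of_lt h, cutRefine_of_lt (hb.1 h), hi, hj]
      · have h' : ¬ p < ((j : {k // c k = c p}) : Fin n) := fun h' => h (hb.2 h')
        rw [cutRefine_of_le (not_lt.1 h), cutRefine_of_le (not_lt.1 h'), hi, hj]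
    change ((u : GL (Fin n) R) : Matrix (Fin n) (Fin n) R) _ _ = _
    rw [hent _ _ hij]
    by_cases h : i = j
    · subst h; simp
    · rw [if_neg (fun e => h (Subtype.ext (Subtype.ext e))), if_neg h]

/-! ### The transitivity step on coinvariants -/

variable {k : Type*} [CommRing k] {V : Type*} [AddCommGroup V] [Module k V]

/-- **`V(U_{c'}) ≤ V(U_c) + V(emb (cutUnipotent))`**: for a representation `π` of `GL_n(R)` and
`u ∈ U_{c'}`, writing `u = emb(m) u₀` with `m ∈ cutUnipotent R c p`, `u₀ ∈ U_c`
(`leviProjection_mem_cutUnipotent`) gives `π(u) v - v = (π(emb m) w - w) + (π(u₀) v - v)` with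
`w = π(u₀) v`. Here `V(H)` is the span of the `π(h) v - v` (`Representation.Coinvariants.ker`).
This is the linear-algebra content of `r_{c'} = r_{cut} ∘ r_c` (Bernstein–Zelevinsky 1977,
Prop. 2.3 (c)). [cite: BernsteinZelevinsky1977, Prop. 2.3(c)] -/
theorem coinvariantsKer_cutRefine_le (π : Representation k (GL (Fin n) R) V) :
    Representation.Coinvariants.ker (Representation.restrictUnipotentGL R (cutRefine c p) π) ≤
      Representation.Coinvariants.ker (Representation.restrictUnipotentGL R c π) ⊔
        Submodule.span k {w | ∃ m ∈ cutUnipotent R c p, ∃ v : V,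
          w = π (blockDiagonalGL R c m) v - v} := by
  rw [Representation.Coinvariants.ker, Submodule.span_le]
  rintro _ ⟨⟨u', v⟩, rfl⟩
  -- `u = emb m · u₀`
  set u : standardParabolicGL R c :=
    ⟨((u' : standardParabolicGL R (cutRefine c p)) : GL (Fin n) R),
      mem_standardParabolicGL_of_cutRefine R hc p (u' : standardParabolicGL R (cutRefine c p)).2⟩
    with hu_def
  set m := leviProjection R c u with hm_def
  have hm : m ∈ cutUnipotent R c p := leviProjection_mem_cutUnipotent R hc p u'.2
  set u₀ : standardParabolicGL R c := (leviEmbeddingP R c m)⁻¹ * u with hu₀_def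
  have hu₀ : u₀ ∈ unipotentRadicalP R c := by
    rw [MonoidHom.mem_ker, hu₀_def, map_mul, map_inv, leviProjection_leviEmbeddingP_apply, ← hm_def,
      inv_mul_cancel]
  have hdec : ((u' : standardParabolicGL R (cutRefine c p)) : GL (Fin n) R) =
      blockDiagonalGL R c m * (u₀ : GL (Fin n) R) := by
    rw [hu₀_def, Subgroup.coe_mul, Subgroup.coe_inv, coe_leviEmbeddingP, mul_inv_cancel_left]
  -- the decomposition of `π(u) v - v`
  change π ((u' : standardParabolicGL R (cutRefine c p)) : GL (Fin n) R) v - v ∈ _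
  rw [hdec, map_mul, Module.End.mul_apply]
  have hsplit : π (blockDiagonalGL R c m) (π (u₀ : GL (Fin n) R) v) - v =
      (π (u₀ : GL (Fin n) R) v - v) +
        (π (blockDiagonalGL R c m) (π (u₀ : GL (Fin n) R) v) - π (u₀ : GL (Fin n) R) v) := by abel
  rw [hsplit]
  refine Submodule.add_mem_sup ?_ (Submodule.subset_span ⟨m, hm, _, rfl⟩)
  exact Representation.Coinvariants.sub_mem_ker (ρ := Representation.restrictUnipotentGL R c π)
    ⟨u₀, hu₀⟩ v

/-- **If `r_{c'} π = 0` then the cut coinvariants of every quotient of `r_c π` vanish.** Suppose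
`V(U_{c'}) = V` for the refinement `c' = cutRefine c p`, and let `ψ : r_c π → σ` be a surjective
intertwining map from the Jacquet module `r_c π` (`Representation.jacquetGL`) to a representation
`σ` of the Levi. Then the `cutUnipotent R c p`-coinvariants of `σ` vanish: every `w ∈ W` lies in
the span of the `σ(m) y - y`, `m ∈ cutUnipotent R c p`. (From `coinvariantsKer_cutRefine_le` and
the right exactness of coinvariants; the instance of "`r_{β} π = r_{β,γ}(r_γ π) = 0` forces the
`β`-Jacquet module of a quotient of `r_γ π` to vanish" used in the proof of Bernstein–Zelevinsky
1977, Thm. 2.5.) [cite: BernsteinZelevinsky1977, Prop. 2.3(c)] -/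
theorem coinvariantsKer_comp_cutUnipotent_eq_top (π : Representation k (GL (Fin n) R) V)
    (h : Representation.Coinvariants.ker (Representation.restrictUnipotentGL R (cutRefine c p) π) = ⊤)
    {W : Type*} [AddCommGroup W] [Module k W]
    (σ : Representation k (Π a, GL {i // c i = a} R) W)
    (ψ : (Representation.jacquetGL R c π).IntertwiningMap σ) (hψ : Function.Surjective ψ) :
    Representation.Coinvariants.ker (σ.comp (cutUnipotent R c p).subtype) = ⊤ := by
  set K := Representation.Coinvariants.ker (σ.comp (cutUnipotent R c p).subtype) with hK
  -- the linear map `v ↦ ψ [v]` sends `span {π(emb m) v - v}` into `K`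
  set L : V →ₗ[k] W := ψ.toLinearMap ∘ₗ
    Representation.Coinvariants.mk (Representation.restrictUnipotentGL R c π) with hL
  have hspan : Submodule.span k {w | ∃ m ∈ cutUnipotent R c p, ∃ v : V,
      w = π (blockDiagonalGL R c m) v - v} ≤ K.comap L := by
    rw [Submodule.span_le]
    rintro _ ⟨m, hm, v, rfl⟩
    rw [SetLike.mem_coe, Submodule.mem_comap, hL, LinearMap.comp_apply, map_sub,
      ← Representation.jacquetGL_mk, map_sub, Representation.IntertwiningMap.coe_toLinearMap,
      ψ.isIntertwining]
    exact Representation.Coinvariants.sub_mem_ker (ρ := σ.comp (cutUnipotent R c p).subtype)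
      ⟨m, hm⟩ _
  have hker : Representation.Coinvariants.ker (Representation.restrictUnipotentGL R c π) ≤
      K.comap L := by
    intro v hv
    rw [Submodule.mem_comap, hL, LinearMap.comp_apply,
      (Representation.Coinvariants.mk_eq_zero _).2 hv, map_zero]
    exact K.zero_mem
  refine eq_top_iff.2 fun w _ => ?_
  obtain ⟨x, rfl⟩ := hψ w
  obtain ⟨v, rfl⟩ := Representation.Coinvariants.mk_surjective _ x
  have hv : v ∈ Representation.Coinvariants.ker
      (Representation.restrictUnipotentGL R (cutRefine c p) π) := by rw [h]; trivial
  have hv' := (coinvariantsKer_cutRefine_le R hc p π).trans (sup_le hker hspan) hv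
  exact hv'

end CutUnipotent

end Literature.NumberTheory.Automorphic
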